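import Literature.MathematicalPhysics.QuantumFieldTheory.Balaban1983to89.B4Ineq116Torus
import Literature.MathematicalPhysics.QuantumFieldTheory.Balaban1983to89.B4StripSumsDeriv

/-!
# B4 Lemma 2.4 (2.35), SECOND QUANTITY, ON THE TORUS for the concrete scalar tower: the `K1`/`K3` kernels of
# (1.136) — the located leaf `B5Ineq137.Leaf235to237` DISCHARGED, and B5 (1.137) for Bałaban's torus tower

B5 = T. Bałaban, *Propagators and renormalization transformations for lattice gauge theories. I*,
Commun. Math. Phys. **95** (1984) 17–40 [cite: Balaban1984PropagatorsI]; [2] of B5 = B4 = T. Bałaban, *Regularity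
and decay of lattice Green's functions*, Commun. Math. Phys. **89** (1983) 571–597 [cite: Balaban1983RegularityDecay];
B1 = *(Higgs)₂,₃ quantum fields in a finite volume I*, Commun. Math. Phys. **85** (1982) 603–636
[cite: Balaban1982Higgs1].
Cell records: GAPS G-pv07-5 residue (R3) = the located leaf `B5Ineq137.Leaf235to237` of `B5Ineq137Torus`; its
conjuncts are `K0` (`B5Leaf237C0Torus.leafK0_torus`, node 5d), `K2` (`B4Ineq116Torus.K2_decay_torus`, node 5f) and
`K1`/`K3` (THIS FILE, which also assembles the leaf); this module = node G-pv07-5g (b2b-balaban-pv07-g7),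
certification C-pv07-28, DIVERGENCE D-pv07.21; v1.1 = DOCFIX only (XREAD C-pv15g5-3 D1–D3: title line, p. 39
locator, K2 wording; GAPS C-pv07-30).  value = kernel certificate for a by-reference step, NOT summit
progress.  Renders `1983-cmp89-regularity-decay-p003/p012/p015-x2.png` read as images by this seat; the B5 p. 39/40
sentences are quoted from the header of `B5Leaf237C0Torus` (renders `1984-cmp95-propagators-rt-I-p023/p024` read by this
lineage; p023 re-read as image by gen 8 for the locator), B4 p. 572 from `B4TorusGreen244` (b04 lineage).

## The printed step

* B5 p. 39 [PDF 23], the four text lines before (1.135): *"In paper [2] we have proved all the necessary properties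
  of G′, except the second order inequalities (1.112), (1.113). Let us prove for example (1.112). We use Lemma 2.4
  of that paper and the equality (2.34) with □ replaced by the whole torus."*; p. 40 [PDF 24]: *"and applying the
  estimates (2.35)–(2.37) of Lemma 2.4 in [2] we obtain … (1.137)"* — (1.136) displays `∂_μG′_k∂^*_ν` through FOUR
  kernels: `C^{(0)}` (`K0`),
  `∂_μG_jQ_j^*` (`K1`), the covariance kernels `C^{(j)}(y, y′)` (`K2`, `B5Display136Torus.K2_eq`) and
  `Q_jG_j∂^*_ν` (`K3`)
  (`B5Display136Torus.display136_of_tower`, `K1_eq`/`K2_eq`/`K3_eq`).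
* B4 p. 582 [PDF 12]: *"Lemma 2.4. There exist positive constants c₀, δ₀, and for α < 1, there exists a constant c₁,
  such that |(G_j(□)Q_j^*)(x, y)|, |(∂^{L^{−j}}_μ G_j(□)Q_j^*)(x, y)| ≤ c₀e^{−δ₀|x−y|}, (2.35) … for arbitrary
  non-negative integer j, arbitrary, rectangular parallelepiped □ ⊂ L^{−j}Z^d built of large blocks, and x, x′ ∈ □,
  y, y′ ∈ □^{(j)} = □∩Z^d."* — THIS FILE: the SECOND quantity, on the whole torus.
* B4 p. 573 [PDF 3]: *"[Of course ∂^η_μ is a difference derivative defined by (∂^η_μA)(x) = η^{−1}(A(x + ηe_μ) −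
  A(x)).]"* — the tower's `B1RG242Torus.deriv P 0 (ε/(L^jε)) μ` (`deriv_mulVec`), step `ξ = L^{−j}` in the units of
  the level-`j` unit lattice (`B4Ineq116Torus.eps_div_spacing`).
* B4 p. 585 [PDF 15], after (2.49): *"where Δ¹(p′) = Σ_{μ=1}^d |e^{−ip′_μ} − 1|² + m_j², ∂^ξ_μ(p) = (e^{iξp_μ} −
  1)/ξ,"* — the second quantity of (2.35) is the momentum formula (2.48) with its `l`-th term multiplied by the symbol
  `∂^ξ_μ(p′+l)`; its volume-, level-, mass-, offset- and direction-uniform exponential decay ON THE TORUS is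
  kernel-proved by the b04 lineage: `B4StripSumsDeriv.dkernel248_torusKernel_decay_torusMetric` (finite-torus kernel
  `torusKernelD248`; *"proof supplied by the audit, not printed"*), whose scope left the identification of
  `torusKernelD248` with the kernel of the OPERATOR `∂^{L^{−j}}_μG_jQ_j^*` of a concrete tower to the consumer —
  supplied here (§1–§2), exactly as `B4Ineq116Torus` §3 did for the underived kernel.
* The torus: B4 p. 572 *"Another common case is to consider operators on subsets of a torus T_η which we identify
  with a rectangular parallelepiped in ηZ^d with periodic conditions."*

## What this module does (all for Bałaban's concrete scalar torus tower `B1RG242Torus.tower`, U = 1)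

* §1 (Fourier side) `GDfull` = the differentiated `l`-sum read at a fine point `z ∈ ℤ^d`; **`GDfull_eq_sub`**:
  `GDfull(z; μ; p′) = n·(Gfull(z + e_μ; p′) − Gfull(z; p′))` — multiplying the `l`-th term by `∂^ξ_μ(p′+l) =
  n(e^{i(p′_μ+l_μ)/n} − 1)` IS the forward difference quotient in the fine variable (`B4Green244.PhZ_add_e`);
  `GDfull_eq_phase_mul_GD` (block phase × b04's `GD`); the fine-point kernel `KTD n a m² μ N z y := torusKernelD248 n a
  m² (z mod n) μ N (⌊z/n⌋ − y)` and **`KTD_eq_sub`**: `K_T^{∂,μ}(z, y) = n·(K_T(z + e_μ, y) − K_T(z, y))` with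
  `K_T = B4TorusGreen244.KT` (finite momentum sums: `KT_eq_sum`, `KTD_eq_sum`).
* §2 (tower side) `deriv_mul_apply`, `K1_mk`: `K1_j(μ; x, y) = L^j[(G_j^{resc}Q_j^*)(x + e_μ, y) − (G_j^{resc}Q_j^*)(x,
  y)]`; **`K3_eq_K1`**: `K3_j(ν; u, x′) = K1_j(ν; x′, u)` (`Q_j = L^{−jd}(Q_j^*)ᵀ`, `G_j^{resc}` symmetric —
  `B4Ineq115Torus.Grs_isSymm`; both vanish off the level); `blk_eq_proj`, `dXU_le_T_add_one`: the leaf's distance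
  `d_{XU}(x,(j,y)) = L^{−j}|x − L^jy|_{T^{(0)}}` is at most the block distance `T^{(j)}(proj x, y) + 1`; **`K1_eq_KTD`**
  (one volume `P = mkP d′ L m K`): `K1_j(μ; x, y) = K_T^{∂,μ}(rep x, rep y)` at `n = L^j`, `a_j`, `m_j² = (L^jε)²m²`,
  `N = Nv P j` — by `B4Ineq116Torus.GQ_eq_KT` at `x` and at `x + e_μ` (periodicity of the column across the seam,
  `colKT_periodic`) and `KTD_eq_sub`.
* §3 `DecayHypD` / `decayHypD_exists` (b04's theorem for the window `a_j ∈ [a(1 − L^{−2}), a]`, `m_j² ∈ [0, m²₊]`);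
  `K1_bound_of`: `|K1_j(μ; x, y)| ≤ M·C(κ,d′)·e^{−κ/(d′+1)·T^{(j)}(proj x, y)}`; `K13_bound_of`: the `K1` AND `K3`
  lines in the distance `d_{XU}` with `c13 = M·C(κ,d′)·e^{κ/(d′+1)}`.
* §4 **`K13_decay_torus`** — (2.35), second quantity, UNIFORMLY: for `d ≥ 1`, odd `L > 1`, `a > 0`, `m²₊` there are
  `δ₀ > 0`, `c₀ ≥ 0`, FUNCTIONS OF `d, L, a, m²₊` ONLY, with `|K1_j(μ; x, u)| ≤ c₀e^{−δ₀d_{XU}(x,u)}`,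
  `|K3_j(ν; u, x′)| ≤ c₀e^{−δ₀d_{XU}(x′,u)}` for EVERY volume (m, K), every `m² ≥ 0`, every top level `k ≤ m + K`
  with `(L^kε)²m² ≤ m²₊`, every `1 ≤ j < k` and all arguments (by `cases P`).
* §5 **`leafK123_torus`**, **`leaf235to237_torus`**: `B5Ineq137.Leaf235to237 (scaleData P S (aux P S cube comp) a m²)
  P.L c₀ δ′₀` for EVERY volume, every `B5.Setting` with `S.k ≤ m + K` under the cap, every cube relation and
  component map, with `c₀ = max(cK0, c₁)`, `δ′₀ = min(dK0, δ₁)` depending on `d, L, a, m², m²₊` only (assembly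
  `B5Leaf237C0Torus.leaf235to237_of_K123` of K0 + K2 + K1/K3, `decay_mono`); `abs_aSeq_le` (`|a_j| ≤ a`);
  **`ineq137_torus_leaf`**: B5 (1.137) `B5Ineq137.Ineq137` for the concrete tower with `δ = ½δ′₀` and the explicit
  constant of `B5Ineq137Torus.ineq137_torus_model` (`c = 2`, `ā = a`), given only an isometric identification `σ` of
  `B5.Setting`'s abstract sites with `T^{(k)}` (residue (R-link), not a statement about the torus).

## Dictionary / HONEST SCOPE

(i) ξ-units (`n = L^j`, fine point `rep x ∈ ℤ^d`, block label `⌊rep x/L^j⌋ = rep (proj x)`, `rep_proj`); the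
(length)^{−2} of (2.34) is divided out in `B5Display136Torus` (`Grs`, `deriv_rescale`, `K1_eq`).  (ii) Dimension
`Fin (d′+1)` at one volume (b04's convention), all `P : Params` with `P.d = d ≥ 1`, `P.L = L` in §4–§5 (`cases P`).
(iii) The mass cap `(L^{k}ε)²m² ≤ m²₊` at the top level `k = S.k` (then at every `j < k`, `spacing_le_spacing`) is
the hypothesis under which b04's constants are uniform; `leaf235to237_torus` fixes `m²` before the constants because
`cK0`/`dK0` (node 5d) depend on it.  (iv) `K3` is bounded through `K3 = K1ᵀ` in the distance `d_{XU}(x′, u)` — the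
form `LeafK123` asks.  (v) Distance: sup torus metric; `d_{XU} ≤ T^{(j)} + 1` costs the factor `e^{κ/(d′+1)}` in `c13`.
(vi) Levels `j ≥ 1` only in the `K1`/`K3` lines (the leaf asks `1 ≤ j < k`); `a₀`'s junk value never enters
(`abs_aSeq_le` is used only for `|a_j| ≤ ā` in (1.137)).

## NOT-CERTIFIED and DIVERGENCE D-pv07.21

(a) Regions □ ⊂ L^{−j}Z^d with Neumann conditions (the printed generality of Lemma 2.4, via the reflections (2.42)):
none — whole torus only, which is the case B5 p. 39 consumes (*"with □ replaced by the whole torus"*).  (b) U ≠ 1 /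
background field (residue (R2)).  (c) The Hölder quantity (2.36): not here (not a conjunct of the leaf).  (d) The
constants are explicit functions of b04's existential `(κ, M)` (contour shift) and of node 5d's `cK0, dK0` — no
numerical values.  (e) The identification `σ` of `B5.Setting` with `T^{(k)}` stays a hypothesis of
`ineq137_torus_leaf` (R-link).  (f) Bałaban applies (2.35) to `Q_jG_j∂^*_ν` without comment; here `K3 = K1ᵀ` is a
proved identity of the concrete tower (`K3_eq_K1`).

## DISTINCTNESS (other formalizations in the tree)

`B4StripSumsDeriv` (b04-g8) proves the decay of the Fourier-side kernel `torusKernelD248` and its fine-lattice Green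
identity in the TRANSLATED variable (`torusGreenOffsetD`); it does not mention the B1RG242Torus tower.  `B4Ineq116Torus`
(node 5f) identifies the UNDERIVED column `G_j^{resc}Q_j^*δ_y` with `B4TorusGreen244.KT`; the present file adds the
difference-quotient dictionary (§1) and the derivative/transposed kernels `K1`/`K3` (§2), re-proves nothing of either,
and imports no `Beta` module and not `B4BoxCov237` (boxes with the box Green machinery, pv17).

Versions: v1 (this file).
-/

namespace Literature.MathematicalPhysics.QuantumFieldTheory.Balaban1983to89

namespace B5Leaf235Torus

noncomputable section

/-! ## §1 The Fourier side: b04's differentiated multiplier `GD` / torus kernel `torusKernelD248` read at a fine point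
IS `n·(Gfull(z + e_μ) − Gfull(z))` / `n·(K_T(z + e_μ, y) − K_T(z, y))` -/

section Fourier

open Complex Finset
open B4Strip B4StripSums B4StripSumsHolder B4Green244 B4StripSumsDeriv B4TorusGreen244 B4Torus248Decay

variable {d : ℕ}

/-- THE DIFFERENTIATED MULTIPLIER READ AT THE FINE POINT `z ∈ ℤ^d`: `GDfull(z; μ; p′) = Σ_k ∂^ξ_μ(p′+2πk) e^{i(p′+2πk)·z/n}
V(k;p′) R_k(p′)/E(p′)` — the `l`-sum of (2.48) with the full phase, each term multiplied by the printed symbol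
`∂^ξ_μ(p′+l) = n(e^{i(p′_μ+l_μ)/n} − 1)` of (2.49) (`B4StripSumsDeriv.D`). [cite: Balaban1983RegularityDecay, (2.48)–(2.49) p.585] -/
def GDfull (n : ℕ) [NeZero n] (a m2 : ℝ) (z : Fin d → ℤ) (μ : Fin d) (p : Fin d → ℂ) : ℂ :=
  ∑ k : Fin d → Fin n, D n (k μ : ℕ) (p μ) * (PhZ n k z p * V n k p * R n m2 k p / E n a m2 p)

/-- **THE DIFFERENCE-DERIVATIVE DICTIONARY** (p. 573: *"(∂^η_μA)(x) = η^{−1}(A(x+ηe_μ) − A(x))"*, `η = ξ = 1/n`): multiplying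
the `l`-th term of (2.48) by `∂^ξ_μ(p′+l)` IS taking the forward difference quotient of the full multiplier in the fine
variable: `GDfull(z; μ; p′) = n·(Gfull(z + e_μ; p′) − Gfull(z; p′))`. [cite: Balaban1983RegularityDecay, p.573 with (2.48)–(2.49)
p.585] [folklore] -/
theorem GDfull_eq_sub (n : ℕ) [NeZero n] (a m2 : ℝ) (z : Fin d → ℤ) (μ : Fin d) (p : Fin d → ℂ) :
    GDfull n a m2 z μ p = (n : ℂ) * (Gfull n a m2 (z + e μ) p - Gfull n a m2 z p) := by
  unfold GDfull Gfull
  rw [← Finset.sum_sub_distrib, Finset.mul_sum]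
  refine Finset.sum_congr rfl fun k _ => ?_
  rw [PhZ_add_e, D, mul_div_assoc]
  ring

/-- at `z = n x⁰ + τ`: `GDfull(z; μ; p′) = e^{ip′·x⁰} GD_{n,a,m²,τ,μ}(p′)` (b04's block-offset multiplier
`B4StripSumsDeriv.GD` times the block phase; cf. `B4Green244.Gfull_finePt`). [cite: Balaban1983RegularityDecay,
(2.48)–(2.49) p.585] [folklore] -/
theorem GDfull_finePt (n : ℕ) [NeZero n] (a m2 : ℝ) (x : Fin d → ℤ) (τ : Fin d → Fin n) (μ : Fin d)
    (P : Fin d → ℂ) : GDfull n a m2 (finePt n x τ) μ P = cexp (I * phaseC P x) * GD n a m2 τ μ P := by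
  unfold GDfull GD termD term F V
  rw [Finset.mul_sum]
  refine Finset.sum_congr rfl fun k _ => ?_
  rw [PhZ_finePt n (NeZero.ne n), mul_assoc (cexp _), ← Finset.prod_mul_distrib]
  ring

/-- `GDfull(z; μ; p′) = e^{ip′·⌊z/n⌋} GD(z mod n; μ; p′)`. [folklore] -/
theorem GDfull_eq_phase_mul_GD (n : ℕ) [NeZero n] (a m2 : ℝ) (z : Fin d → ℤ) (μ : Fin d) (P : Fin d → ℂ) :
    GDfull n a m2 z μ P = cexp (I * phaseC P (coarse n z)) * GD n a m2 (offset n z) μ P := by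
  have h := GDfull_finePt n a m2 (coarse n z) (offset n z) μ P
  rwa [finePt_coarse_offset] at h

/-- THE FINITE-TORUS KERNEL OF `∂^ξ_μ G_jQ_j^*` READ AT A FINE POINT: `K_T^{∂,μ}(z, y) := torusKernelD248 n a m² (z mod n) μ N
(⌊z/n⌋ − y)` (`B4StripSumsDeriv.torusKernelD248` in the fine-point reading of `B4TorusGreen244.KT`).
[cite: Balaban1983RegularityDecay, (2.35) p.582 with (2.48)–(2.49) p.585 and p.572 (torus); dictionary] [folklore] -/
def KTD (n : ℕ) [NeZero n] (a m2 : ℝ) (μ : Fin (d + 1)) (N : Fin (d + 1) → ℕ) (z y : Fin (d + 1) → ℤ) : ℂ :=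
  torusKernelD248 n a m2 (offset n z) μ N (coarse n z - y)

/-- `torusKernelD248` written with `dualMomentum` (definitional). [folklore] -/
theorem torusKernelD248_eq_dual (n : ℕ) [NeZero n] (a m2 : ℝ) (τ : Fin (d + 1) → Fin n) (μ : Fin (d + 1))
    (N : Fin (d + 1) → ℕ) (x : Fin (d + 1) → ℤ) :
    torusKernelD248 n a m2 τ μ N x = (∏ i, ((N i : ℕ) : ℂ))⁻¹ * ∑ k : (i : Fin (d + 1)) → Fin (N i),
      GD n a m2 τ μ (ofRealVec (dualMomentum N k)) * UnitAddTorus.mFourier x (B4TorusKernel.MultiPeriod.gridPt N k) :=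
  rfl

/-- Green form of the differentiated torus kernel: `K_T^{∂,μ}(z,y) = Σ_k [(Π N)⁻¹ e^{−ip′_k·y}] · GDfull(z; μ; p′_k)`. [folklore] -/
theorem KTD_eq_sum (n : ℕ) [NeZero n] (a m2 : ℝ) (μ : Fin (d + 1)) (N : Fin (d + 1) → ℕ) (z y : Fin (d + 1) → ℤ) :
    KTD n a m2 μ N z y = ∑ k : (i : Fin (d + 1)) → Fin (N i),
      ((∏ i, ((N i : ℕ) : ℂ))⁻¹ * cexp (-(I * phaseC (ofRealVec (dualMomentum N k)) y)))
        * GDfull n a m2 z μ (ofRealVec (dualMomentum N k)) := by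
  unfold KTD
  rw [torusKernelD248_eq_dual, Finset.mul_sum]
  refine Finset.sum_congr rfl fun k _ => ?_
  rw [mFourier_gridPt, GDfull_eq_phase_mul_GD, phaseC_sub, mul_sub, Complex.exp_sub, Complex.exp_neg, div_eq_mul_inv]
  ring

/-- **THE DERIVATIVE KERNEL IS THE DIFFERENCE QUOTIENT OF THE KERNEL**: `K_T^{∂,μ}(z, y) = n·(K_T(z + e_μ, y) − K_T(z, y))` —
b04's `torusKernelD248` (descended differentiated multiplier) is LITERALLY the forward `ξ`-difference quotient in the fine
variable of b04's `torusKernel248`/`KT` (p. 573's definition of `∂^ξ_μ` applied to (2.48) on the torus).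
[cite: Balaban1983RegularityDecay, p.573, (2.35) p.582, (2.48)–(2.49) p.585 with p.572 (torus); dictionary] [folklore] -/
theorem KTD_eq_sub (n : ℕ) [NeZero n] (a m2 : ℝ) (μ : Fin (d + 1)) (N : Fin (d + 1) → ℕ) (z y : Fin (d + 1) → ℤ) :
    KTD n a m2 μ N z y = (n : ℂ) * (KT n a m2 N (z + e μ) y - KT n a m2 N z y) := by
  rw [KTD_eq_sum, KT_eq_sum, KT_eq_sum, ← Finset.sum_sub_distrib, Finset.mul_sum]
  refine Finset.sum_congr rfl fun k _ => ?_
  rw [GDfull_eq_sub]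
  ring

end Fourier

/-! ## §2 The tower side: `K1`/`K3` of (1.136) are the (transposed) kernel `∂^{L^{−j}}_μ G_j^{resc}Q_j^*`, and that kernel
IS b04's `torusKernelD248` for the concrete tower -/

section Tower

open Matrix B1RG242Torus B5Display136Torus B5Leaf237C0Torus B4Ineq115Torus B5Ineq137Torus B4Ineq116Torus
open B4Green244 (coarse offset e)

variable {P : Params}

/-- Entries of a left lattice derivative of a kernel: `(∂^s_μ M)(x, y) = s⁻¹(M(x + e_μ, y) − M(x, y))` ((1.4) of B1 /
p. 573 of B4 applied to the column `M(·, y)`). [cite: Balaban1983RegularityDecay, p.573] [folklore] -/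
theorem deriv_mul_apply {ι : Type*} (s : ℝ) (μ : Fin P.d) (M : Matrix (Site P 0) ι ℝ) (x : Site P 0) (y : ι) :
    (deriv P 0 s μ * M) x y = s⁻¹ * (M (Site.shift x μ) y - M x y) := by
  rw [Matrix.mul_apply']
  exact deriv_mulVec s μ (fun x' => M x' y) x

/-- `K1` ON ITS LEVEL: `K1_j(μ; x, y) = (∂^{L^{−j}}_μ G_j^{resc}Q_j^*)(x, y) = L^j·[(G_j^{resc}Q_j^*)(x + e_μ, y) − (G_j^{resc}Q_j^*)(x, y)]`
(fine lattice `L^{−j}ℤ^d`, `ξ = L^{−j}`; `B5Display136Torus.K1_eq` + the entry formula). [cite: Balaban1984PropagatorsI,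
(1.136) p.40; Balaban1983RegularityDecay, (2.35) p.582, p.573] -/
theorem K1_mk {a msq : ℝ} (ha : 0 < a) (hm : 0 ≤ msq) {j : ℕ} (hj1 : 1 ≤ j) (μ : Fin P.d) (x : Site P 0)
    (y : Site P j) :
    K1 P a msq j μ x ⟨j, y⟩
      = (P.L : ℝ) ^ j * ((Grs P a msq j * Qks P j) (Site.shift x μ) y - (Grs P a msq j * Qks P j) x y) := by
  rw [K1_eq (P := P) ha hm hj1 μ x y]
  show (deriv P 0 (P.eps / P.spacing j) μ * Grs P a msq j * Qks P j) x y = _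
  rw [Matrix.mul_assoc, deriv_mul_apply, eps_div_spacing P j, one_div, inv_inv]

/-- **`K3` IS `K1` READ BACKWARDS**: `K3_j(ν; u, x′) = K1_j(ν; x′, u)` — because `Q_j = L^{−jd}·(Q_j^*)ᵀ` and `G_j^{resc}` is
symmetric, `L^{jd}·(Q_jG_j^{resc}∂^{*}_ν)(y, x′) = (∂_νG_j^{resc}Q_j^*)(x′, y)`; off the level both vanish.
[cite: Balaban1984PropagatorsI, (1.136) p.40] [folklore] -/
theorem K3_eq_K1 {a msq : ℝ} (ha : 0 < a) (hm : 0 ≤ msq) {j : ℕ} (hj1 : 1 ≤ j) (hj : j ≤ P.m + P.K) (ν : Fin P.d)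
    (u : (i : ℕ) × Site P i) (x' : Site P 0) : K3 P a msq j ν u x' = K1 P a msq j ν x' u := by
  obtain ⟨i, y⟩ := u
  by_cases hi : j = i
  · subst hi
    rw [K3_eq (P := P) ha hm hj1 ν y x', K1_eq (P := P) ha hm hj1 ν x' y]
    show (P.L : ℝ) ^ (j * P.d) * (Qk P j * Grs P a msq j * (deriv P 0 (P.eps / P.spacing j) ν)ᵀ) y x'
      = (deriv P 0 (P.eps / P.spacing j) ν * Grs P a msq j * Qks P j) x' y
    have hQk : Qk P j = wj P j • (Qks P j)ᵀ := by
      rw [Qk_eq, avgMat_eq_smul_transpose]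
      rfl
    have hT : Qk P j * Grs P a msq j * (deriv P 0 (P.eps / P.spacing j) ν)ᵀ
        = wj P j • (deriv P 0 (P.eps / P.spacing j) ν * Grs P a msq j * Qks P j)ᵀ := by
      rw [hQk, Matrix.smul_mul, Matrix.smul_mul, Matrix.transpose_mul, Matrix.transpose_mul,
        (Grs_isSymm (P := P) a msq j).eq, Matrix.mul_assoc]
    rw [hT, Matrix.smul_apply, Matrix.transpose_apply, smul_eq_mul, ← mul_assoc, wj_eq_inv P hj, ← pow_mul,
      mul_inv_cancel₀ (pow_ne_zero _ P.cast_L_pos.ne'), one_mul]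
  · rw [K3, K1, atLevel_of_ne (P := P) _ _ ⟨i, y⟩ (fun h' => hi h'.symm),
      atLevel_of_ne (P := P) _ _ ⟨i, y⟩ (fun h' => hi h'.symm), mul_zero, mul_zero]

/-- The block map of `B5Ineq137Torus` is the tower's projection: `blk_j = proj_j` on `T^{(0)}`. [folklore] -/
theorem blk_eq_proj {j : ℕ} (hj : j ≤ P.m + P.K) (x : Site P 0) : blk P j x = Site.proj j j x := by
  have h0 : P.sitesPerDir 0 = P.L ^ j * P.sitesPerDir j := by rw [sitesPerDir_zero_eq P j, lvl_of_le P hj]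
  funext μ
  apply ZMod.val_injective
  rw [blk_val P hj x μ, Site.val_proj h0 x μ]

/-- THE DISTANCE DICTIONARY for `K1`/`K3`: the leaf's `d_{XU}(x, (j,y)) = L^{−j}|x − L^j y|_{T^{(0)}}` (η-units, corner
representative) exceeds the block distance `|proj x − y|_{T^{(j)}}` by at most `1`. [folklore] -/
theorem dXU_le_T_add_one {j : ℕ} (hj : j ≤ P.m + P.K) (x : Site P 0) (y : Site P j) :
    dXU P j x ⟨j, y⟩ ≤ T P j (Site.proj j j x) y + 1 := by
  have hLj : (0 : ℝ) < (P.L : ℝ) ^ j := pow_pos P.cast_L_pos _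
  have t := T_triangle P 0 x (fine P j (blk P j x)) (fine P j y)
  have h1 := T_blk_le P hj x
  have h2 := T_fine_fine P hj (blk P j x) y
  rw [blk_eq_proj hj x] at t h1 h2
  show ((P.L : ℝ) ^ j)⁻¹ * T P 0 x (fine P j y) ≤ _
  rw [inv_mul_le_iff₀ hLj]
  nlinarith [T_nonneg P j (Site.proj j j x) y]

/-! ### The identification at one volume (`P = mkP d′ L m K`, b04's dimension convention `Fin (d′+1)`) -/

variable (d' Lb mb Kb : ℕ) (hL : Odd Lb ∧ 1 < Lb) [NeZero Lb]

local notation "Pm" => mkP d' Lb mb Kb hL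

/-- **IDENTIFICATION OF THE DERIVATIVE KERNEL** (closes `B4StripSumsDeriv`'s fine-point reading for the concrete tower):
for `a > 0`, `m² ≥ 0`, `1 ≤ j ≤ m + K`, `K1_j(μ; x, y) = K_T^{∂,μ}(rep x, rep y) = torusKernelD248 (L^j) a_j (L^jε)²m²
(rep x mod L^j) μ N (⌊rep x/L^j⌋ − rep y)` — by `B4Ineq116Torus.GQ_eq_KT` at `x` and `x + e_μ` (periodicity across the
seam) and `KTD_eq_sub`. [cite: Balaban1983RegularityDecay, (2.35) p.582 with (2.48)–(2.49) p.585, p.573 and p.572 (torus);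
dictionary] [folklore] -/
theorem K1_eq_KTD {a msq : ℝ} (ha : 0 < a) (hm : 0 ≤ msq) {j : ℕ} (hj1 : 1 ≤ j) (hj : j ≤ mb + Kb)
    (μ : Fin (d' + 1)) (x : Site Pm 0) (y : Site Pm j) :
    ((K1 Pm a msq j μ x ⟨j, y⟩ : ℝ) : ℂ)
      = KTD ((Pm).L ^ j) (B1.aSeq a Lb j) ((Pm).spacing j ^ 2 * msq) μ (Nv Pm j) (rep Pm x) (rep Pm y) := by
  rw [K1_mk ha hm hj1 μ x y, Complex.ofReal_mul, Complex.ofReal_sub,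
    GQ_eq_KT d' Lb mb Kb hL ha hm hj1 hj (Site.shift x μ) y, GQ_eq_KT d' Lb mb Kb hL ha hm hj1 hj x y,
    (colKT_periodic d' Lb mb Kb hL a msq hj y).shift x μ, KTD_eq_sub]
  unfold colKT
  push_cast
  rfl

end Tower

/-! ## §3 (2.35) on the torus, second quantity: uniform decay of `K1`/`K3` at one volume and level -/

section Decay

open Matrix B1RG242Torus B5Display136Torus B5Leaf237C0Torus B4Ineq115Torus B5Ineq137Torus B4Ineq116Torus
open B4Green244 (coarse offset e)
open B4StripSumsDeriv (torusKernelD248)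

variable (d' Lb mb Kb : ℕ) (hL : Odd Lb ∧ 1 < Lb) [NeZero Lb]

local notation "Pm" => mkP d' Lb mb Kb hL

/-- The decay hypothesis package of `B4StripSumsDeriv.dkernel248_torusKernel_decay_torusMetric` at the constants of the
tower: `a₋ = a(1 − L^{−2})`, `a₊ = a`, mass cap `m²₊` (as `B4Ineq116Torus.DecayHyp` for the underived kernel). [folklore] -/
def DecayHypD (a m2plus κ M : ℝ) : Prop :=
  ∀ (n : ℕ) [NeZero n] (a' m2 : ℝ), a * (1 - ((Lb : ℝ) ^ 2)⁻¹) ≤ a' → a' ≤ a → 0 ≤ m2 → m2 ≤ m2plus →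
    ∀ (τ : Fin (d' + 1) → Fin n) (μ : Fin (d' + 1)) (N : Fin (d' + 1) → ℕ), (∀ i, 1 ≤ N i) →
      ∀ x : Fin (d' + 1) → ℤ,
        ‖torusKernelD248 n a' m2 τ μ N x‖
          ≤ M * B4TorusKernel.periodConst κ d' *
              Real.exp (-(κ / (d' + 1) * B4TorusKernel.MultiPeriod.torusSupNorm N x))

omit [NeZero Lb] in
/-- The package holds with constants depending on `d′, L, a, m²₊` only (b04's theorem, second quantity of (2.35)).
[cite: Balaban1983RegularityDecay, (2.35) p.582 (second quantity) with (2.48)–(2.51) pp.585–586; dictionary] [folklore] -/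
theorem decayHypD_exists {a : ℝ} (ha : 0 < a) (hL1 : (1 : ℝ) < Lb) (m2plus : ℝ) :
    ∃ κ M : ℝ, 0 < κ ∧ 0 ≤ M ∧ DecayHypD d' Lb a m2plus κ M :=
  B4StripSumsDeriv.dkernel248_torusKernel_decay_torusMetric d' (a * (1 - ((Lb : ℝ) ^ 2)⁻¹)) a m2plus (ainf_pos ha hL1)

/-- (2.35) on the torus, SECOND quantity, AT ONE VOLUME AND LEVEL, from the decay package:
`|K1_j(μ; x, y)| ≤ M·C(κ,d′)·e^{−κ/(d′+1)·T^{(j)}(proj x, y)}`. [cite: Balaban1983RegularityDecay, Lemma 2.4 (2.35) p.582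
(second quantity) with p.572 (torus); dictionary] [folklore] -/
theorem K1_bound_of {a m2plus κ M : ℝ} (ha : 0 < a) (hκ : 0 < κ) (hM : 0 ≤ M) (hdec : DecayHypD d' Lb a m2plus κ M)
    {msq : ℝ} (hmsq : 0 ≤ msq) {j : ℕ} (hj1 : 1 ≤ j) (hj : j ≤ mb + Kb) (hcap : (Pm).spacing j ^ 2 * msq ≤ m2plus)
    (μ : Fin (d' + 1)) (x : Site Pm 0) (y : Site Pm j) :
    |K1 Pm a msq j μ x ⟨j, y⟩|
      ≤ M * B4TorusKernel.periodConst κ d' * Real.exp (-(κ / (d' + 1) * T Pm j (Site.proj j j x) y)) := by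
  have hL1 : (1 : ℝ) < Lb := by exact_mod_cast hL.2
  have h0 : (Pm).sitesPerDir 0 = (Pm).L ^ j * (Pm).sitesPerDir j := by
    rw [sitesPerDir_zero_eq Pm j, lvl_of_le Pm hj]
  have hC : 0 ≤ M * B4TorusKernel.periodConst κ d' := mul_nonneg hM (periodConst_nonneg hκ.le d')
  have e := K1_eq_KTD d' Lb mb Kb hL ha hmsq hj1 hj μ x y
  have hn : |K1 Pm a msq j μ x ⟨j, y⟩|
      = ‖KTD ((Pm).L ^ j) (B1.aSeq a Lb j) ((Pm).spacing j ^ 2 * msq) μ (Nv Pm j) (rep Pm x) (rep Pm y)‖ := by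
    rw [← e, Complex.norm_real, Real.norm_eq_abs]
  rw [hn]
  have hb := hdec ((Pm).L ^ j) (B1.aSeq a (Lb : ℝ) j) ((Pm).spacing j ^ 2 * msq)
    (B1.ainf_lt_aSeq ha hL1 j hj1).le (B1.aSeq_le ha hL1 j hj1) (mul_nonneg (sq_nonneg _) hmsq) hcap
    (offset ((Pm).L ^ j) (rep Pm x)) μ (Nv Pm j) (Nv_pos Pm j) (coarse ((Pm).L ^ j) (rep Pm x) - rep Pm y)
  refine le_trans hb ?_
  refine mul_le_mul_of_nonneg_left (Real.exp_le_exp.mpr ?_) hC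
  rw [← rep_proj h0]
  have hT := T_le_torusSupNorm d' Lb mb Kb hL (Site.proj j j x) y
  have hκ' : 0 ≤ κ / (d' + 1) := by positivity
  nlinarith

/-- The constant of the `K1`/`K3` lines: `M·C(κ,d′)·e^{κ/(d′+1)}` (the factor `e^{κ′}` pays for `d_{XU} ≤ T^{(j)} + 1`). [folklore] -/
def c13 (κ M : ℝ) : ℝ := M * B4TorusKernel.periodConst κ d' * Real.exp (κ / (d' + 1))

omit [NeZero Lb] in
/-- `0 ≤ c13`. [folklore] -/
theorem c13_nonneg {κ M : ℝ} (hκ : 0 < κ) (hM : 0 ≤ M) : 0 ≤ c13 d' κ M :=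
  mul_nonneg (mul_nonneg hM (periodConst_nonneg hκ.le d')) (Real.exp_pos _).le

/-- The `K1` AND `K3` lines of the leaf at one volume and level, in the leaf's distance `d_{XU}`:
`|K1_j(μ; x, (j,y))|, |K3_j(ν; (j,y), x)| ≤ c13·e^{−κ/(d′+1)·d_{XU}(x,(j,y))}`. [cite: Balaban1984PropagatorsI, p.39 (before (1.135))
with Balaban1983RegularityDecay (2.35) p.582; dictionary] [folklore] -/
theorem K13_bound_of {a m2plus κ M : ℝ} (ha : 0 < a) (hκ : 0 < κ) (hM : 0 ≤ M) (hdec : DecayHypD d' Lb a m2plus κ M)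
    {msq : ℝ} (hmsq : 0 ≤ msq) {j : ℕ} (hj1 : 1 ≤ j) (hj : j ≤ mb + Kb) (hcap : (Pm).spacing j ^ 2 * msq ≤ m2plus)
    (μ : Fin (d' + 1)) (x : Site Pm 0) (y : Site Pm j) :
    |K1 Pm a msq j μ x ⟨j, y⟩| ≤ c13 d' κ M * Real.exp (-(κ / (d' + 1) * dXU Pm j x ⟨j, y⟩)) ∧
    |K3 Pm a msq j μ ⟨j, y⟩ x| ≤ c13 d' κ M * Real.exp (-(κ / (d' + 1) * dXU Pm j x ⟨j, y⟩)) := by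
  have h1 := K1_bound_of d' Lb mb Kb hL ha hκ hM hdec hmsq hj1 hj hcap μ x y
  have hd := dXU_le_T_add_one (P := Pm) hj x y
  have hC : 0 ≤ M * B4TorusKernel.periodConst κ d' := mul_nonneg hM (periodConst_nonneg hκ.le d')
  have hκ' : 0 ≤ κ / (d' + 1) := by positivity
  have key : |K1 Pm a msq j μ x ⟨j, y⟩| ≤ c13 d' κ M * Real.exp (-(κ / (d' + 1) * dXU Pm j x ⟨j, y⟩)) := by
    refine le_trans h1 ?_
    unfold c13
    rw [mul_assoc (M * B4TorusKernel.periodConst κ d'), ← Real.exp_add]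
    refine mul_le_mul_of_nonneg_left (Real.exp_le_exp.mpr ?_) hC
    nlinarith
  refine ⟨key, ?_⟩
  rw [K3_eq_K1 (P := Pm) ha hmsq hj1 hj μ ⟨j, y⟩ x]
  exact key

end Decay

/-! ## §4 The `K1`/`K3` conjuncts for the concrete tower, uniformly in the volume and the level -/

section Uniform

open Matrix B1RG242Torus B5Display136Torus B5Leaf237C0Torus B4Ineq115Torus B5Ineq137Torus B4Ineq116Torus

/-- **B4 LEMMA 2.4 (2.35), SECOND QUANTITY, ON THE TORUS FOR THE CONCRETE SCALAR TOWER — UNIFORMLY**: for `d ≥ 1`, `L > 1` odd,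
`a > 0` and a mass cap `m²₊` there are `δ₀ > 0`, `c₀ ≥ 0` (functions of `d, L, a, m²₊` only) such that for EVERY volume
(`m`, `K`), every `m² ≥ 0`, every top level `k ≤ m + K` with `(L^kε)²m² ≤ m²₊`, every `1 ≤ j < k` and all arguments,
the kernels `K1_j`, `K3_j` of (1.136) obey `|K1_j(μ; x, u)| ≤ c₀e^{−δ₀ d_{XU}(x,u)}`, `|K3_j(ν; u, x′)| ≤ c₀e^{−δ₀ d_{XU}(x′,u)}`
(zero off the level `j`). [cite: Balaban1983RegularityDecay, Lemma 2.4 (2.35) p.582 (second quantity) with p.572 (torus);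
Balaban1984PropagatorsI, (1.136)–(1.137) p.40] -/
theorem K13_decay_torus (d L : ℕ) (hd : 1 ≤ d) (hL : Odd L ∧ 1 < L) {a : ℝ} (ha : 0 < a) (m2plus : ℝ) :
    ∃ δ₀ c₀ : ℝ, 0 < δ₀ ∧ 0 ≤ c₀ ∧ ∀ (P : Params), P.d = d → P.L = L → ∀ (msq : ℝ), 0 ≤ msq →
      ∀ k : ℕ, k ≤ P.m + P.K → P.spacing k ^ 2 * msq ≤ m2plus →
        ∀ j : ℕ, 1 ≤ j → j < k →
          (∀ (μ : Fin P.d) (x : Site P 0) (u : (i : ℕ) × Site P i),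
              |K1 P a msq j μ x u| ≤ c₀ * Real.exp (-(δ₀ * dXU P j x u))) ∧
          (∀ (ν : Fin P.d) (u : (i : ℕ) × Site P i) (x' : Site P 0),
              |K3 P a msq j ν u x'| ≤ c₀ * Real.exp (-(δ₀ * dXU P j x' u))) := by
  obtain ⟨d', rfl⟩ : ∃ d', d = d' + 1 := ⟨d - 1, by omega⟩
  haveI : NeZero L := ⟨by have := hL.2; omega⟩
  have hL1 : (1 : ℝ) < L := by exact_mod_cast hL.2
  obtain ⟨κ, M, hκ, hM, hdec⟩ := decayHypD_exists d' L ha hL1 m2plus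
  refine ⟨κ / (d' + 1), c13 d' κ M, by positivity, c13_nonneg d' hκ hM, ?_⟩
  intro P hPd hPL msq hmsq k hk hcap j hj1 hjk
  have hj : j ≤ P.m + P.K := hjk.le.trans hk
  have hcapj : P.spacing j ^ 2 * msq ≤ m2plus := by
    refine le_trans ?_ hcap
    exact mul_le_mul_of_nonneg_right
      (pow_le_pow_left₀ (P.spacing_pos j).le (spacing_le_spacing P hjk.le) 2) hmsq
  have hK1 : ∀ (μ : Fin P.d) (x : Site P 0) (u : (i : ℕ) × Site P i),
      |K1 P a msq j μ x u| ≤ c13 d' κ M * Real.exp (-(κ / (d' + 1) * dXU P j x u)) := by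
    intro μ x u
    obtain ⟨i, y⟩ := u
    by_cases hi : j = i
    · subst hi
      obtain ⟨dP, LP, mP, KP, hdP, hLP⟩ := P
      simp only at hPd hPL
      subst hPd hPL
      exact (K13_bound_of d' LP mP KP hLP ha hκ hM hdec hmsq hj1 hj hcapj μ x y).1
    · have e0 : K1 P a msq j μ x ⟨i, y⟩ = 0 := by
        rw [K1, atLevel_of_ne (P := P) _ _ ⟨i, y⟩ (fun h' => hi h'.symm), mul_zero]
      rw [e0, abs_zero]
      exact mul_nonneg (c13_nonneg d' hκ hM) (Real.exp_pos _).le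
  refine ⟨hK1, ?_⟩
  intro ν u x'
  rw [K3_eq_K1 (P := P) ha hmsq hj1 hj ν u x']
  exact hK1 ν x' u

end Uniform

/-! ## §5 The located leaf `B5Ineq137.Leaf235to237` for the concrete tower, and (1.137) -/

section Leaf

open Matrix B1RG242Torus B5Display136Torus B5Leaf237C0Torus B4Ineq115Torus B5Ineq137Torus B4Ineq116Torus

/-- **`LeafK123` FOR THE CONCRETE TOWER** (the `K1`/`K2`/`K3` lines of the located leaf = (2.35) second quantity and
(2.37)/(1.16) on the torus), uniformly: constants depending on `d, L, a, m²₊` only, for every volume, every `m² ≥ 0`,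
every `B5.Setting` with `S.k ≤ m + K` under the mass cap at level `S.k`, every cube relation and component map.
[cite: Balaban1984PropagatorsI, p.39 (before (1.135)), (1.136)–(1.137) p.40; Balaban1983RegularityDecay, Lemma 2.4 (2.35)/(2.37)
p.582] -/
theorem leafK123_torus (d L : ℕ) (hd : 1 ≤ d) (hL : Odd L ∧ 1 < L) {a : ℝ} (ha : 0 < a) (m2plus : ℝ) :
    ∃ δ₀ c₀ : ℝ, 0 < δ₀ ∧ 0 ≤ c₀ ∧ ∀ (P : Params), P.d = d → P.L = L → ∀ (msq : ℝ), 0 ≤ msq →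
      ∀ (S : B5.Setting) (cube : Site P 0 → S.Site → Prop) (comp : S.Loc → Fin P.d → (Site P 0 → ℝ)),
        S.k ≤ P.m + P.K → P.spacing S.k ^ 2 * msq ≤ m2plus →
          LeafK123 S (scaleData P S (aux P S cube comp) a msq) c₀ δ₀ := by
  obtain ⟨δ₁, c₁, hδ₁, hc₁, h13⟩ := K13_decay_torus d L hd hL ha m2plus
  obtain ⟨δ₂, c₂, hδ₂, hc₂, h2⟩ := K2_decay_torus d L hd hL ha m2plus
  refine ⟨min δ₁ δ₂, max c₁ c₂, lt_min hδ₁ hδ₂, le_max_of_le_left hc₁, ?_⟩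
  intro P hPd hPL msq hmsq S cube comp hk hcap j hj1 hjk
  obtain ⟨hK1, hK3⟩ := h13 P hPd hPL msq hmsq S.k hk hcap j hj1 hjk
  have hK2 := h2 P hPd hPL msq hmsq S.k hk hcap j hj1 hjk
  refine ⟨fun μ x u => ?_, fun u u' => ?_, fun ν u x' => ?_⟩
  · show |K1 P a msq j μ x u| ≤ max c₁ c₂ * Real.exp (-(min δ₁ δ₂ * dXU P j x u))
    exact decay_mono (dXU_nonneg P j x u) (le_max_left _ _) hc₁ (min_le_left _ _) (hK1 μ x u)
  · show |K2 P a msq j u u'| ≤ max c₁ c₂ * Real.exp (-(min δ₁ δ₂ * dUU P j u u'))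
    exact decay_mono (dUU_nonneg P j u u') (le_max_right _ _) hc₂ (min_le_right _ _) (hK2 u u')
  · show |K3 P a msq j ν u x'| ≤ max c₁ c₂ * Real.exp (-(min δ₁ δ₂ * dXU P j x' u))
    exact decay_mono (dXU_nonneg P j x' u) (le_max_left _ _) hc₁ (min_le_left _ _) (hK3 ν u x')

/-- **THE LOCATED LEAF, PROVED FOR THE CONCRETE SCALAR TORUS TOWER** (`U = 1`, whole torus): for `d ≥ 1`, `L > 1` odd,
`a > 0`, `m² ≥ 0` and a mass cap `m²₊` there are `δ′₀ > 0`, `c₀ ≥ 0` — functions of `d, L, a, m², m²₊` only — such that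
`B5Ineq137.Leaf235to237 (scaleData P S (aux P S cube comp) a m²) L c₀ δ′₀` holds for EVERY volume (`m`, `K`), every
`B5.Setting` with `S.k ≤ m + K` and `(L^{S.k}ε)²m² ≤ m²₊`, every cube relation and component map: [B4] Lemma 2.4 /
(2.35)–(2.37) as consumed by [B5] (1.136)–(1.137) (`K0` = `B5Leaf237C0Torus.leafK0_torus`, `K2` =
`B4Ineq116Torus.K2_decay_torus`, `K1`/`K3` = §4). [cite: Balaban1984PropagatorsI, p.39 (before (1.135)), (1.136)–(1.137) p.40;
Balaban1983RegularityDecay, Lemma 2.4 (2.35)–(2.37) p.582] -/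
theorem leaf235to237_torus (d L : ℕ) (hd : 1 ≤ d) (hL : Odd L ∧ 1 < L) {a : ℝ} (ha : 0 < a) {msq : ℝ}
    (hmsq : 0 ≤ msq) (m2plus : ℝ) :
    ∃ δ₀' c₀ : ℝ, 0 < δ₀' ∧ 0 ≤ c₀ ∧ ∀ (P : Params), P.d = d → P.L = L →
      ∀ (S : B5.Setting) (cube : Site P 0 → S.Site → Prop) (comp : S.Loc → Fin P.d → (Site P 0 → ℝ)),
        S.k ≤ P.m + P.K → P.spacing S.k ^ 2 * msq ≤ m2plus →
          B5Ineq137.Leaf235to237 (scaleData P S (aux P S cube comp) a msq) P.L c₀ δ₀' := by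
  obtain ⟨δ₁, c₁, hδ₁, hc₁, h123⟩ := leafK123_torus d L hd hL ha m2plus
  refine ⟨min (dK0 d L a msq) δ₁, max (cK0 d L a msq) c₁, ?_, le_max_of_le_right hc₁, ?_⟩
  · -- positivity of `dK0` is stated over a `Params`; any volume with these `d, L` will do
    have hP : ∃ P : Params, P.d = d ∧ P.L = L := ⟨⟨d, L, 0, 0, hd, hL⟩, rfl, rfl⟩
    obtain ⟨P, rfl, rfl⟩ := hP
    exact lt_min (dK0_pos (P := P) ha hmsq) hδ₁
  intro P hPd hPL S cube comp hk hcap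
  have h := h123 P hPd hPL msq hmsq S cube comp hk hcap
  subst hPd hPL
  refine leaf235to237_of_K123 cube comp ha hmsq (le_max_left _ _) (min_le_left _ _) ?_
  intro j hj1 hjk
  obtain ⟨hK1, hK2, hK3⟩ := h j hj1 hjk
  refine ⟨fun μ x u => ?_, fun u u' => ?_, fun ν u x' => ?_⟩
  · show |K1 P a msq j μ x u| ≤ max (cK0 P.d P.L a msq) c₁ * Real.exp (-(min (dK0 P.d P.L a msq) δ₁ * dXU P j x u))
    exact decay_mono (dXU_nonneg P j x u) (le_max_right _ _) hc₁ (min_le_right _ _) (hK1 μ x u)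
  · show |K2 P a msq j u u'| ≤ max (cK0 P.d P.L a msq) c₁ * Real.exp (-(min (dK0 P.d P.L a msq) δ₁ * dUU P j u u'))
    exact decay_mono (dUU_nonneg P j u u') (le_max_right _ _) hc₁ (min_le_right _ _) (hK2 u u')
  · show |K3 P a msq j ν u x'| ≤ max (cK0 P.d P.L a msq) c₁ * Real.exp (-(min (dK0 P.d P.L a msq) δ₁ * dXU P j x' u))
    exact decay_mono (dXU_nonneg P j x' u) (le_max_right _ _) hc₁ (min_le_right _ _) (hK3 ν u x')

/-- `|a_j| ≤ a` for all `j` (`a_0 = 0` by the junk value of (2.19) at `k = 0`, `0 < a_j ≤ a` for `j ≥ 1`). [folklore] -/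
theorem abs_aSeq_le {a L : ℝ} (ha : 0 < a) (hL : 1 < L) (j : ℕ) : |B1.aSeq a L j| ≤ a := by
  rcases Nat.eq_zero_or_pos j with rfl | hj
  · simp [B1.aSeq, ha.le]
  · rw [abs_of_pos (B1.aSeq_pos ha hL hj)]
    exact B1.aSeq_le ha hL j hj

/-- **B5 (1.137) FOR THE CONCRETE SCALAR TORUS TOWER, THE LEAF DISCHARGED.**  Under the model cube relation of an isometric
identification `σ` of the abstract unit-lattice sites of `B5.Setting` with `T^{(k)}` (`1 ≤ k = S.k ≤ m + K`) and the mass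
cap `(L^kε)²m² ≤ m²₊`: (1.137) `B5Ineq137.Ineq137` holds for `scaleData P S (aux P S (modelCube k σ) comp) a m²` with
`δ = ½δ′₀` and the explicit constant of `B5Ineq137Torus.ineq137_torus_model` (`c = 2`, `ā = a`), where `δ′₀, c₀` are the
leaf constants of `leaf235to237_torus` — functions of `d, L, a, m², m²₊` only, uniform in the volume.  Every hypothesis of
`B5Ineq137.ineq137_of_display136` is now a kernel theorem for the concrete tower except the identification `σ` itself.
[cite: Balaban1984PropagatorsI, (1.135)–(1.137) pp.39–40] -/
theorem ineq137_torus_leaf (d L : ℕ) (hd : 1 ≤ d) (hL : Odd L ∧ 1 < L) {a : ℝ} (ha : 0 < a) {msq : ℝ}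
    (hmsq : 0 ≤ msq) (m2plus : ℝ) :
    ∃ δ₀' c₀ : ℝ, 0 < δ₀' ∧ 0 ≤ c₀ ∧ ∀ (P : Params), P.d = d → P.L = L →
      ∀ (S : B5.Setting) (comp : S.Loc → Fin P.d → (Site P 0 → ℝ)), 1 ≤ S.k → S.k ≤ P.m + P.K →
        P.spacing S.k ^ 2 * msq ≤ m2plus →
        ∀ (σ : S.Site → Site P S.k), (∀ y y' : S.Site, S.dist y y' = T P S.k (σ y) (σ y')) →
          B5Ineq137.Ineq137 (scaleData P S (aux P S (modelCube S.k σ) comp) a msq)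
            (fun ε => 2 * ((c₀ + a ^ 2 * c₀ ^ 3 *
                (Real.exp (δ₀' / 4) * B4Sect5Proof.latticeConst P.d (δ₀' / 4)) ^ 2) *
              Real.exp (δ₀' / 2 * 2) * Lam P.d (δ₀' / 4)) / ((P.L : ℝ) ^ ε - 1)) (δ₀' / 2) := by
  obtain ⟨δ₀', c₀, hδ, hc, hleaf⟩ := leaf235to237_torus d L hd hL ha hmsq m2plus
  refine ⟨δ₀', c₀, hδ, hc, ?_⟩
  intro P hPd hPL S comp hk1 hk hcap σ hσ
  have hL1 : (1 : ℝ) < P.L := by rw [hPL]; exact_mod_cast hL.2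
  exact ineq137_torus_model ha hmsq hk1 hk σ hσ c₀ δ₀' a hc hδ (fun j => abs_aSeq_le ha hL1 j)
    (hleaf P hPd hPL S (modelCube S.k σ) comp hk hcap)

end Leaf

end

end B5Leaf235Torus

end Literature.MathematicalPhysics.QuantumFieldTheory.Balaban1983to89
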